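import Literature.Analysis.FluidPDE.Tao2016AveragedNS.GateRetuning
import HarnessLib

/-!
# Tao 2016, §5.5 — structured increment and pairing identities of the (retuned) delay circuit

T. Tao, *Finite time blowup for an averaged three-dimensional Navier–Stokes equation*, J. Amer.
Math. Soc. **29** (2016) 601–674 = arXiv:1402.0290, §5.1 (pump), §5.3 (amplifier), §5.4
(rotor), §5.5 (the five-mode delay circuit (5.5), "basically because the system is composed of
gates, each of which obeys the cancellation condition").

HONEST FRAMING (cell pub-fluidc, blueprint seat 1): low prior, high value-of-information
experiment on Tao's machine paradigm; NOT a claim that NS blows up. This file contains no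
Navier–Stokes statement. It records, as exact polynomial identities, how a displacement `W` of the
state is transported by each wired gate and by the retuned circuit `delayCircuitWith K M ε`
(`GateRetuning.lean`; Tao's (5.5) is the member `M = K¹⁰`):

* `pumpOn_add_sub_apply`, `amplifierOn_add_sub_apply`, `rotorOn_add_sub_apply` — the increment
  `G (X + W) - G X` of a wired gate, coordinate by coordinate: a part LINEAR in `W` (the
  linearisation at `X`) plus a part QUADRATIC in `W`;
* `delayCircuitWith_add_sub_apply_zero … _four` — the same for the five coordinates of the
  retuned circuit; in particular the `c`-coordinate (index 2) receives NOTHING from the rotor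
  (`rotorOn_add_sub_apply_driver`): the rotor `ε⁻² : c ∘ (a,d)` is a cascade `c → (a,d)`;
* `pairing_pumpOn_add_sub`, `pairing_amplifierOn_add_sub`, `pairing_rotorOn_add_sub` — the
  `ℓ²`-pairing `∑ₗ W l * (G (X+W) l - G X l)` of the increment against the displacement: the cubic
  terms cancel by (g-cancel) applied to `W`, leaving `κ (Xᵢ Wᵢ Wⱼ - Xⱼ Wᵢ²)` (pump),
  `κ (Xᵢ Wⱼ² - Xⱼ Wᵢ Wⱼ)` (amplifier), `κ W_k (Xᵢ Wⱼ - Xⱼ Wᵢ)` (rotor);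
* `pairing_delayCircuitWith_add_sub` — their sum for the circuit, and
  `abs_pairing_delayCircuitWith_add_sub_le` — the STRUCTURED RATE
  `|pairing| ≤ structuredRateWith K M ε X * ‖W‖²` with
  `structuredRateWith = |ε|(|a|+|b|) + ε²e^{-M}(|a|+|c|) + |ε⁻¹M|(|b|+|c|) + |ε⁻²|(|a|+|d|) + |K|(|d|+|ã|)`
  evaluated at the BASE state `X` only;
* `hasDerivAt_energy_sub` — `∂ₜ ∑(Y-X)² = 2·pairing(F(Y)-F(X)) + 2·pairing(defect)` for a
  trajectory `X` of a field `F` and any differentiable `Y`.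

What the identities show (docstring of `pairing_delayCircuitWith_add_sub`): the `ε⁻²` in the
generic Lipschitz constant `delayLipschitzWith` (`RetunedFlow.lean`) is the rotor term
`ε⁻² W_c (X_a W_d - X_d W_a)` with `X_a ≈ 1` on the reference trajectory — present in the energy
pairing, so not removable by an energy argument in a fixed norm; but it is a CASCADE term (it moves
a `c`-displacement into `d` at rate `ε⁻² X_a`, and nothing back into `c`), which is the input a
perturbative version of Theorem 5.3 would exploit. No dynamics is proved here beyond the chain rule.
-/

namespace Literature.Analysis.FluidPDE.Tao2016AveragedNS

open Finset

variable {m : ℕ}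

/-! ## Increments of the wired gates -/

/-- Increment of a wired pump under a displacement `W`, coordinatewise.
[cite: Tao2016AveragedNS, §5.1 (pump)] -/
theorem pumpOn_add_sub_apply (κ : ℝ) (i j : Fin m) (X W : Fin m → ℝ) (l : Fin m) :
    pumpOn κ i j (X + W) l - pumpOn κ i j X l =
      ((Pi.single i (-(κ * (X i * W j + W i * X j + W i * W j))) : Fin m → ℝ) +
        (Pi.single j (κ * (2 * X i * W i + W i ^ 2)) : Fin m → ℝ)) l := by
  simp only [pumpOn, Pi.add_apply, Pi.single_apply]
  split_ifs <;> ring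

/-- Increment of a wired amplifier under a displacement `W`, coordinatewise.
[cite: Tao2016AveragedNS, §5.3 (amp)] -/
theorem amplifierOn_add_sub_apply (κ : ℝ) (i j : Fin m) (X W : Fin m → ℝ) (l : Fin m) :
    amplifierOn κ i j (X + W) l - amplifierOn κ i j X l =
      ((Pi.single i (-(κ * (2 * X j * W j + W j ^ 2))) : Fin m → ℝ) +
        (Pi.single j (κ * (X i * W j + W i * X j + W i * W j)) : Fin m → ℝ)) l := by
  simp only [amplifierOn, Pi.add_apply, Pi.single_apply]
  split_ifs <;> ring

/-- Increment of a wired rotor under a displacement `W`, coordinatewise.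
[cite: Tao2016AveragedNS, §5.4 (rotor-def)] -/
theorem rotorOn_add_sub_apply (κ : ℝ) (i j k : Fin m) (X W : Fin m → ℝ) (l : Fin m) :
    rotorOn κ i j k (X + W) l - rotorOn κ i j k X l =
      ((Pi.single i (-(κ * (X j * W k + W j * X k + W j * W k))) : Fin m → ℝ) +
        (Pi.single j (κ * (X i * W k + W i * X k + W i * W k)) : Fin m → ℝ)) l := by
  simp only [rotorOn, Pi.add_apply, Pi.single_apply]
  split_ifs <;> ring

/-- **The rotor is a cascade**: its driver mode `k` (distinct from the two rotated modes) receives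
nothing, whatever the displacement. [cite: Tao2016AveragedNS, §5.4 (rotor-def)] -/
theorem rotorOn_add_sub_apply_driver (κ : ℝ) {i j k : Fin m} (hki : k ≠ i) (hkj : k ≠ j)
    (X W : Fin m → ℝ) : rotorOn κ i j k (X + W) k - rotorOn κ i j k X k = 0 := by
  rw [rotorOn_add_sub_apply]
  simp [hki, hkj]

/-! ## Increments of the retuned circuit, coordinate by coordinate -/

/-- `a`-increment: `-ε⁻²(X_c W_d + W_c X_d + W_c W_d) - ε(X_a W_b + W_a X_b + W_a W_b)
 - ε²e^{-M}(X_a W_c + W_a X_c + W_a W_c)`. [cite: Tao2016AveragedNS, §5.5 (5.5)] -/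
theorem delayCircuitWith_add_sub_apply_zero (K M ε : ℝ) (X W : Fin 5 → ℝ) :
    delayCircuitWith K M ε (X + W) 0 - delayCircuitWith K M ε X 0 =
      -((ε ^ 2)⁻¹ * (X 2 * W 3 + W 2 * X 3 + W 2 * W 3)) -
        ε * (X 0 * W 1 + W 0 * X 1 + W 0 * W 1) -
        ε ^ 2 * Real.exp (-M) * (X 0 * W 2 + W 0 * X 2 + W 0 * W 2) := by
  simp [delayCircuitWith]; ring

/-- `b`-increment: `ε(2 X_a W_a + W_a²) - ε⁻¹M(2 X_c W_c + W_c²)`.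
[cite: Tao2016AveragedNS, §5.5 (5.5)] -/
theorem delayCircuitWith_add_sub_apply_one (K M ε : ℝ) (X W : Fin 5 → ℝ) :
    delayCircuitWith K M ε (X + W) 1 - delayCircuitWith K M ε X 1 =
      ε * (2 * X 0 * W 0 + W 0 ^ 2) - ε⁻¹ * M * (2 * X 2 * W 2 + W 2 ^ 2) := by
  simp [delayCircuitWith]; ring

/-- `c`-increment: `ε²e^{-M}(2 X_a W_a + W_a²) + ε⁻¹M(X_b W_c + W_b X_c + W_b W_c)` — no rotor
term: the trigger mode drives the rotor and receives nothing from it.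
[cite: Tao2016AveragedNS, §5.5 (5.5)] -/
theorem delayCircuitWith_add_sub_apply_two (K M ε : ℝ) (X W : Fin 5 → ℝ) :
    delayCircuitWith K M ε (X + W) 2 - delayCircuitWith K M ε X 2 =
      ε ^ 2 * Real.exp (-M) * (2 * X 0 * W 0 + W 0 ^ 2) +
        ε⁻¹ * M * (X 1 * W 2 + W 1 * X 2 + W 1 * W 2) := by
  simp [delayCircuitWith]; ring

/-- `d`-increment: `ε⁻²(X_c W_a + W_c X_a + W_c W_a) - K(X_d W_ã + W_d X_ã + W_d W_ã)` — a
`c`-displacement `W_c` is fed into `d` at rate `ε⁻² X_a`. [cite: Tao2016AveragedNS, §5.5 (5.5)] -/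
theorem delayCircuitWith_add_sub_apply_three (K M ε : ℝ) (X W : Fin 5 → ℝ) :
    delayCircuitWith K M ε (X + W) 3 - delayCircuitWith K M ε X 3 =
      (ε ^ 2)⁻¹ * (X 2 * W 0 + W 2 * X 0 + W 2 * W 0) -
        K * (X 3 * W 4 + W 3 * X 4 + W 3 * W 4) := by
  simp [delayCircuitWith]; ring

/-- `ã`-increment: `K(2 X_d W_d + W_d²)`. [cite: Tao2016AveragedNS, §5.5 (5.5)] -/
theorem delayCircuitWith_add_sub_apply_four (K M ε : ℝ) (X W : Fin 5 → ℝ) :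
    delayCircuitWith K M ε (X + W) 4 - delayCircuitWith K M ε X 4 =
      K * (2 * X 3 * W 3 + W 3 ^ 2) := by
  simp [delayCircuitWith]; ring

/-! ## Pairing identities: the cubic terms cancel -/

/-- `∑ₗ W l * (δᵢ(a) + δⱼ(b))ₗ = a Wᵢ + b Wⱼ`. [folklore] -/
theorem sum_mul_single_add_single (i j : Fin m) (a b : ℝ) (W : Fin m → ℝ) :
    ∑ l, W l * ((Pi.single i a : Fin m → ℝ) + (Pi.single j b : Fin m → ℝ)) l =
      a * W i + b * W j := by
  simp [Pi.single_apply, Finset.sum_add_distrib, mul_add, mul_ite, mul_comm]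

/-- **Pump pairing**: `∑ₗ W l (pump(X+W) - pump(X))ₗ = κ (Xᵢ Wᵢ Wⱼ - Xⱼ Wᵢ²)`; the cubic terms
cancel by (g-cancel) applied to `W`. [cite: Tao2016AveragedNS, §5.1 (pump)] -/
theorem pairing_pumpOn_add_sub (κ : ℝ) (i j : Fin m) (X W : Fin m → ℝ) :
    ∑ l, W l * (pumpOn κ i j (X + W) l - pumpOn κ i j X l) =
      κ * (X i * W i * W j - X j * W i ^ 2) := by
  simp_rw [pumpOn_add_sub_apply, sum_mul_single_add_single]
  ring

/-- **Amplifier pairing**: `∑ₗ W l (amp(X+W) - amp(X))ₗ = κ (Xᵢ Wⱼ² - Xⱼ Wᵢ Wⱼ)`.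
[cite: Tao2016AveragedNS, §5.3 (amp)] -/
theorem pairing_amplifierOn_add_sub (κ : ℝ) (i j : Fin m) (X W : Fin m → ℝ) :
    ∑ l, W l * (amplifierOn κ i j (X + W) l - amplifierOn κ i j X l) =
      κ * (X i * W j ^ 2 - X j * W i * W j) := by
  simp_rw [amplifierOn_add_sub_apply, sum_mul_single_add_single]
  ring

/-- **Rotor pairing**: `∑ₗ W l (rotor(X+W) - rotor(X))ₗ = κ W_k (Xᵢ Wⱼ - Xⱼ Wᵢ)`.
[cite: Tao2016AveragedNS, §5.4 (rotor-def)] -/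
theorem pairing_rotorOn_add_sub (κ : ℝ) (i j k : Fin m) (X W : Fin m → ℝ) :
    ∑ l, W l * (rotorOn κ i j k (X + W) l - rotorOn κ i j k X l) =
      κ * (W k * (X i * W j - X j * W i)) := by
  simp_rw [rotorOn_add_sub_apply, sum_mul_single_add_single]
  ring

/-- **Circuit pairing** for the retuned delay circuit (`a,b,c,d,ã = 0,…,4`):
`∑ₗ W l (F(X+W) - F(X))ₗ = ε(X_a W_a W_b - X_b W_a²) + ε²e^{-M}(X_a W_a W_c - X_c W_a²)
 + ε⁻¹M(X_b W_c² - X_c W_b W_c) + ε⁻² W_c (X_a W_d - X_d W_a) + K(X_d W_d W_ã - X_ã W_d²)`.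
The `ε⁻²` of the generic Lipschitz constant is the rotor term `ε⁻² W_c (X_a W_d - X_d W_a)`, with
`X_a ≈ 1` on the reference trajectory of Theorem 5.3: it survives in the energy pairing (so no
energy argument in a fixed norm removes it), and it is a cascade term (`c → d`, nothing back).
[cite: Tao2016AveragedNS, §5.5 (5.5)] -/
theorem pairing_delayCircuitWith_add_sub (K M ε : ℝ) (X W : Fin 5 → ℝ) :
    ∑ l, W l * (delayCircuitWith K M ε (X + W) l - delayCircuitWith K M ε X l) =
      ε * (X 0 * W 0 * W 1 - X 1 * W 0 ^ 2) +
        ε ^ 2 * Real.exp (-M) * (X 0 * W 0 * W 2 - X 2 * W 0 ^ 2) +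
        ε⁻¹ * M * (X 1 * W 2 ^ 2 - X 2 * W 1 * W 2) +
        (ε ^ 2)⁻¹ * (W 2 * (X 0 * W 3 - X 3 * W 0)) +
        K * (X 3 * W 3 * W 4 - X 4 * W 3 ^ 2) := by
  simp [delayCircuitWith, Fin.sum_univ_five]
  ring

/-- Tao's member: the same identity for (5.5) (`M = K¹⁰`). [cite: Tao2016AveragedNS, §5.5 (5.5)] -/
theorem pairing_delayCircuit_add_sub (K ε : ℝ) (X W : Fin 5 → ℝ) :
    ∑ l, W l * (delayCircuit K ε (X + W) l - delayCircuit K ε X l) =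
      ε * (X 0 * W 0 * W 1 - X 1 * W 0 ^ 2) +
        ε ^ 2 * Real.exp (-K ^ 10) * (X 0 * W 0 * W 2 - X 2 * W 0 ^ 2) +
        ε⁻¹ * K ^ 10 * (X 1 * W 2 ^ 2 - X 2 * W 1 * W 2) +
        (ε ^ 2)⁻¹ * (W 2 * (X 0 * W 3 - X 3 * W 0)) +
        K * (X 3 * W 3 * W 4 - X 4 * W 3 ^ 2) := by
  rw [← delayCircuitWith_pow_ten]
  exact pairing_delayCircuitWith_add_sub K (K ^ 10) ε X W

/-! ## The structured rate -/

/-- The **structured rate** of the retuned circuit at the base state `X = (a,b,c,d,ã)`: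
`|ε|(|a|+|b|) + ε²e^{-M}(|a|+|c|) + |ε⁻¹M|(|b|+|c|) + |ε⁻²|(|a|+|d|) + |K|(|d|+|ã|)` — the
coefficient of `‖W‖²` in the energy pairing, gate by gate, each coupling weighted by the base
coordinates it actually sees. [cite: Tao2016AveragedNS, §5.5 (5.5)] -/
noncomputable def structuredRateWith (K M ε : ℝ) (X : Fin 5 → ℝ) : ℝ :=
  |ε| * (|X 0| + |X 1|) + ε ^ 2 * Real.exp (-M) * (|X 0| + |X 2|) +
    |ε⁻¹ * M| * (|X 1| + |X 2|) + |(ε ^ 2)⁻¹| * (|X 0| + |X 3|) + |K| * (|X 3| + |X 4|)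

/-- The structured rate is nonnegative. [folklore] -/
theorem structuredRateWith_nonneg (K M ε : ℝ) (X : Fin 5 → ℝ) :
    0 ≤ structuredRateWith K M ε X := by
  unfold structuredRateWith; positivity

/-- One gate's pairing term against the sup norm: `|Xᵢ Wᵢ Wⱼ - Xⱼ Wᵢ²| ≤ (|Xᵢ| + |Xⱼ|)‖W‖²`.
[folklore] -/
theorem abs_pairing_term_le (X W : Fin m → ℝ) (i j p q r s : Fin m) :
    |X i * W p * W q - X j * W r * W s| ≤ (|X i| + |X j|) * ‖W‖ ^ 2 := by
  have hW : ∀ l, |W l| ≤ ‖W‖ := fun l => by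
    rw [← Real.norm_eq_abs]; exact norm_le_pi_norm W l
  have h1 : |X i * W p * W q| ≤ |X i| * ‖W‖ ^ 2 := by
    rw [abs_mul, abs_mul, mul_assoc, sq]
    exact mul_le_mul_of_nonneg_left (mul_le_mul (hW p) (hW q) (abs_nonneg _) (norm_nonneg _))
      (abs_nonneg _)
  have h2 : |X j * W r * W s| ≤ |X j| * ‖W‖ ^ 2 := by
    rw [abs_mul, abs_mul, mul_assoc, sq]
    exact mul_le_mul_of_nonneg_left (mul_le_mul (hW r) (hW s) (abs_nonneg _) (norm_nonneg _))
      (abs_nonneg _)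
  calc |X i * W p * W q - X j * W r * W s| ≤ |X i * W p * W q| + |X j * W r * W s| :=
        abs_sub _ _
    _ ≤ |X i| * ‖W‖ ^ 2 + |X j| * ‖W‖ ^ 2 := add_le_add h1 h2
    _ = (|X i| + |X j|) * ‖W‖ ^ 2 := by ring

/-- **Structured rate bound**: `|∑ₗ W l (F(X+W) - F(X))ₗ| ≤ structuredRateWith K M ε X · ‖W‖²`
(sup norm). The rate depends on the BASE state only; on the reference trajectory of Theorem 5.3
(`a ≈ 1`) its `|ε⁻²|(|a|+|d|)` summand is `≈ ε⁻²` — the honest content of the generic constant.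
[cite: Tao2016AveragedNS, §5.5 (5.5)] -/
theorem abs_pairing_delayCircuitWith_add_sub_le (K M ε : ℝ) (X W : Fin 5 → ℝ) :
    |∑ l, W l * (delayCircuitWith K M ε (X + W) l - delayCircuitWith K M ε X l)| ≤
      structuredRateWith K M ε X * ‖W‖ ^ 2 := by
  rw [pairing_delayCircuitWith_add_sub]
  have t0 := abs_pairing_term_le X W 0 1 0 1 0 0
  have t1 := abs_pairing_term_le X W 0 2 0 2 0 0
  have t2 := abs_pairing_term_le X W 1 2 2 2 1 2
  have t3 := abs_pairing_term_le X W 0 3 2 3 2 0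
  have t4 := abs_pairing_term_le X W 3 4 3 4 3 3
  have e0 : X 0 * W 0 * W 1 - X 1 * W 0 ^ 2 = X 0 * W 0 * W 1 - X 1 * W 0 * W 0 := by ring
  have e1 : X 0 * W 0 * W 2 - X 2 * W 0 ^ 2 = X 0 * W 0 * W 2 - X 2 * W 0 * W 0 := by ring
  have e2 : X 1 * W 2 ^ 2 - X 2 * W 1 * W 2 = X 1 * W 2 * W 2 - X 2 * W 1 * W 2 := by ring
  have e3 : W 2 * (X 0 * W 3 - X 3 * W 0) = X 0 * W 2 * W 3 - X 3 * W 2 * W 0 := by ring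
  have e4 : X 3 * W 3 * W 4 - X 4 * W 3 ^ 2 = X 3 * W 3 * W 4 - X 4 * W 3 * W 3 := by ring
  rw [e0, e1, e2, e3, e4]
  have hexp : 0 ≤ ε ^ 2 * Real.exp (-M) := by positivity
  calc _ ≤ |ε * (X 0 * W 0 * W 1 - X 1 * W 0 * W 0)| +
          |ε ^ 2 * Real.exp (-M) * (X 0 * W 0 * W 2 - X 2 * W 0 * W 0)| +
          |ε⁻¹ * M * (X 1 * W 2 * W 2 - X 2 * W 1 * W 2)| +
          |(ε ^ 2)⁻¹ * (X 0 * W 2 * W 3 - X 3 * W 2 * W 0)| +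
          |K * (X 3 * W 3 * W 4 - X 4 * W 3 * W 3)| := by
        have key : ∀ a b c d e : ℝ, |a + b + c + d + e| ≤ |a| + |b| + |c| + |d| + |e| := by
          intro a b c d e
          have := abs_add_le (a + b + c + d) e; have := abs_add_le (a + b + c) d
          have := abs_add_le (a + b) c; have := abs_add_le a b
          linarith
        exact key _ _ _ _ _
    _ ≤ |ε| * ((|X 0| + |X 1|) * ‖W‖ ^ 2) +
          ε ^ 2 * Real.exp (-M) * ((|X 0| + |X 2|) * ‖W‖ ^ 2) +
          |ε⁻¹ * M| * ((|X 1| + |X 2|) * ‖W‖ ^ 2) +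
          |(ε ^ 2)⁻¹| * ((|X 0| + |X 3|) * ‖W‖ ^ 2) +
          |K| * ((|X 3| + |X 4|) * ‖W‖ ^ 2) := by
        rw [abs_mul ε, abs_mul (ε ^ 2 * Real.exp (-M)), abs_of_nonneg hexp, abs_mul (ε⁻¹ * M),
          abs_mul ((ε ^ 2)⁻¹), abs_mul K]
        gcongr
    _ = structuredRateWith K M ε X * ‖W‖ ^ 2 := by unfold structuredRateWith; ring

/-! ## The energy of a difference -/

/-- **Chain rule for the energy of a difference, with the defect split off**: if `X` solves
`∂ₜX = F(X)` at `t` and `Y` has derivative `V` at `t`, then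
`∂ₜ ∑ₗ (Y-X)ₗ² = 2 ∑ₗ (Y-X)ₗ (F(Y) - F(X))ₗ + 2 ∑ₗ (Y-X)ₗ (V - F(Y))ₗ` — structured pairing plus
defect pairing. [cite: HairerNorsettWanner1993, Thm I.10.2] -/
theorem hasDerivAt_energy_sub {F : (Fin m → ℝ) → (Fin m → ℝ)} {X Y : ℝ → Fin m → ℝ}
    {V : Fin m → ℝ} {t : ℝ} (hX : HasDerivAt X (F (X t)) t) (hY : HasDerivAt Y V t) :
    HasDerivAt (fun s => energy (Y s - X s))
      (2 * ∑ l, (Y t l - X t l) * (F (Y t) l - F (X t) l) +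
        2 * ∑ l, (Y t l - X t l) * (V l - F (Y t) l)) t := by
  have h := hasDerivAt_energy (X := fun s => Y s - X s) (hY.sub hX)
  refine h.congr_deriv ?_
  rw [← mul_add, ← Finset.sum_add_distrib]
  congr 1
  refine Finset.sum_congr rfl fun l _ => ?_
  simp only [Pi.sub_apply]
  ring

/-- The same with the base point written as `X t` and the displacement `W = Y t - X t`, so that
`pairing_delayCircuitWith_add_sub` / `abs_pairing_delayCircuitWith_add_sub_le` apply verbatim to
the first sum. [cite: HairerNorsettWanner1993, Thm I.10.2] -/
theorem hasDerivAt_energy_sub' {F : (Fin m → ℝ) → (Fin m → ℝ)} {X Y : ℝ → Fin m → ℝ}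
    {V : Fin m → ℝ} {t : ℝ} (hX : HasDerivAt X (F (X t)) t) (hY : HasDerivAt Y V t) :
    HasDerivAt (fun s => energy (Y s - X s))
      (2 * ∑ l, (Y t - X t) l * (F (X t + (Y t - X t)) l - F (X t) l) +
        2 * ∑ l, (Y t - X t) l * (V l - F (Y t) l)) t := by
  have h := hasDerivAt_energy_sub hX hY
  simpa only [Pi.sub_apply, add_sub_cancel] using h

/-- **Structured energy inequality for two exact trajectories** of the retuned circuit: at every
time, `∂ₜ ∑(Y-X)² ≤ 2 · structuredRateWith K M ε (X t) · ‖Y t - X t‖²` (sup norm on the right).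
[cite: Tao2016AveragedNS, §5.5 (5.5)] -/
theorem deriv_energy_sub_le {K M ε : ℝ} {X Y : ℝ → Fin 5 → ℝ} {t : ℝ}
    (hX : HasDerivAt X (delayCircuitWith K M ε (X t)) t)
    (hY : HasDerivAt Y (delayCircuitWith K M ε (Y t)) t) :
    deriv (fun s => energy (Y s - X s)) t ≤
      2 * structuredRateWith K M ε (X t) * ‖Y t - X t‖ ^ 2 := by
  rw [(hasDerivAt_energy_sub' hX hY).deriv]
  simp only [sub_self, mul_zero, Finset.sum_const_zero, add_zero]
  have h := abs_pairing_delayCircuitWith_add_sub_le K M ε (X t) (Y t - X t)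
  have := (le_abs_self _).trans h
  linarith

end Literature.Analysis.FluidPDE.Tao2016AveragedNS
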